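import Summits.ResolutionOfSingularities.ResolutionOfSingularities.Theses.Descent
import Summits.ResolutionOfSingularities.ResolutionOfSingularities.Theorems.PAlterationPialtAtomsOpenRange
import Summits.ResolutionOfSingularities.ResolutionOfSingularities.Theorems.PAlterationPalterationThesisLuPerfectDisplay
import Literature.AlgebraicGeometry.Resolution.ZariskiPatchingProperModelsWeakLU
import Literature.AlgebraicGeometry.Resolution.LocalUniformization
import Literature.AlgebraicGeometry.Resolution.ProperModelsPatching
import Literature.AlgebraicGeometry.Resolution.ResolutionLU
import Literature.AlgebraicGeometry.Resolution.AffineDomainDimension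
import Literature.AlgebraicGeometry.Resolution.MuPTorsorLocalUniformizationRelative
import Literature.AlgebraicGeometry.Resolution.MuPTorsorOpenCore
import HarnessLib

/-!
# Crux `DescentPerfectToAll` (stmt-ResolutionOfSingularities-0549) — line `valuative-constant-step`
# (planner `res-B-lens-3` g2, lens «Picover / p-alteration», 2026-08-28; crux idea `Ideas/valuative-constant-step.md`,
# critic res-B-crit-1 TRIAGE-3 #60: KEEP / new-combination / probes CLEAN ×5 / flags [EQ] [D4] [LOC] — this file answers [LOC])

Line card: `Lines/valuative-constant-step.md`.  HONEST FRAMING: nothing in this file proves resolution of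
singularities in characteristic `p`; rung B (`DescentPerfectToAll`) stays OPEN; `[OURS · CANDIDATE]`, counted 0.

## The cut — the crux through Zariski's reduction, localized along ONE valuation and ONE constant radicial step

By `resolutionInChar_iff_twoModelPatching_and_lu` (tree, sorry-free) the crux's consequent `ResolutionInChar p` is
`TwoModelPatching p ∧ LocalUniformizationInChar p`.  Under the crux's antecedent (resolution over PERFECT fields of
characteristic `p`), and after the tree's SORRY-FREE reductions of relative local uniformization —
Novacoski–Spivakovsky 2014 (rank one, `NovacoskiSpivakovsky2014_holds`), the residually-algebraic ground-field
enlargement (`relLocalUniformization_of_forall_isResiduallyAlgebraic`), Cutkosky 2022 Thm 1.3 at Abhyankar places over ANY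
field (`relLocalUniformization_of_isAbhyankarPlace`, PROVED) — and the two PRINTED theorems Cossart–Piltant 2019 (dim `≤ 3`)
and Knaf–Kuhlmann 2009 Thm 1.5 (discrete, finite separable residue extension), what rung B still owes splits as

* `stub_constStepDescent` (OPEN, HARDEST, the line's lever): ONE-CONSTANT-STEP DESCENT of a relative-LU certificate —
  `k ⊆ K ⊆ L = K(y)` with `y ^ p ∈ k` (a `p`-th root of a CONSTANT), a finitely generated `k`-algebra `B ⊆ O_L` containing the
  affine model `R ⊆ K`, regular at the centre of `O_L`; conclude: some finitely generated `A ⊇ R` inside `O_K = O_L ∩ K` is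
  regular at the centre of `O_K` — asked ONLY on the OPEN CORE of valuation rings `O_K` (rank one, residually algebraic over
  `k`, not discrete-with-separable-residue, not Abhyankar, `trdeg_k K ≥ 4`).  Trivial over perfect `k` (`y ∈ k`, `L = K`,
  `A := B`); a consequence of `ResolutionInChar p` (`constStepDescent_of_resolutionInChar`, proved below);
* `stub_coreDescent` (bookkeeping, M/L, believed provable with tree tools): the antecedent + Knaf–Kuhlmann + the step give
  relative LU on the open core — ascend to the perfect closure `k' = k^{p^{-∞}}` (resolution over `k'` ⇒ a regular affine
  model `A' ⊇ R·k'` inside `O'`, `exists_affineModel_regular_of_hasResolution`), descend `A'` to a finite constant level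
  `kₙ = k(c₁^{1/pⁿ},…,c_s^{1/pⁿ})` where `K·kₙ/kₙ` is separable (flat descent of regularity,
  `IsRegularLocalRing.of_flat_of_isLocalHom`), then peel the height-one CONSTANT tower `K·kₙ ⊋ … ⊋ K` top-down with the step
  (levels whose valuation ring is discrete with separable residue are dispatched by Knaf–Kuhlmann; the core conditions are
  invariant along the purely inseparable tower);
* `stub_twoModelPatchingImperfectGeFour` (OPEN, shared debt with route Valuative's `PatchingRel` stmt-0642): two-model
  patching of proper models over IMPERFECT `k` in `trdeg ≥ 4`, granted the antecedent (perfect `k`: the antecedent through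
  `resOver_iff_luAt_and_tmpAt`; `trdeg ≤ 3`: `twoModelPatching_of_trdeg_le_three (hCP)`);
* `stub_cossartPiltant2019`, `stub_knafKuhlmann2009` : the two named printed facts, typed and undischarged in the tree.

`DescentPerfectToAll_of` : the five stub STATEMENTS → the crux BY NAME (kernel-checked, no sorry outside `stub_*`);
`DescentPerfectToAll_proof` : the item decl from the five stubs by name (the register's skeleton theorem).
Register reading: **rung B ⊇ (one-constant-step descent of LU on the open core, trdeg ≥ 4) + (two-model patching over
imperfect fields, trdeg ≥ 4), modulo Cossart–Piltant 2019 and Knaf–Kuhlmann 2009.**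
## v2 (g3, 2026-08-28): stub 4 SPLIT by the valuation type of the generator (E ramified / F inert / D immediate)

`stub_constStepDescent` is no longer a sorry: it is DERIVED (`constStepDescent_of_substubs`) from three case-restricted
sub-stubs `stub_constStepDescent_ramified / _inert / _immediate` through the kernel-checked case assembly
`constStepDescent_of_cases` (pure logic; `ImmediateGen := ¬ RamifiedGen ∧ ¬ InertGen`).  The predicates are LINEAR
WITNESSES over `K` (`RamifiedGen`: `∃ a, v(y-a) ∉ v(K)`; `InertGen`: `∃ a b, (y-a)/b` a unit with residue not a residue of
`K`); `constStepDescentIf_of_constStepDescent` proves each sub-stub is WEAKER than the old stub.  Also typed: the minimal hard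
family `DiscreteInseparableResidueLU p` (discrete rank one, residue field purely inseparable over `k` and `≠ k`: outside every
Knaf–Kuhlmann mechanism — KK 2009 Thm 1.5 needs `F₀P|KP` separable and, by its Lemma 3.12, a defect constant step is never in
the completion of an Abhyankar subfield), with `discreteInseparableResidueLU_of_resolutionInChar`.  Stub-plan:
`Lines/valuative-constant-step-efd.md`.  Probes of the three sub-stubs and of the family vs crux / summit / old stub: CLEAN ×12.
Registered stubs are now SEVEN: CP2019, KK2009, coreDescent, ramified, inert, immediate (HARDEST), TMP≥4; the composition
`DescentPerfectToAll_of7` concludes the crux BY NAME from the seven statements.  Counted 0; rung B OPEN.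
-/

noncomputable section

set_option linter.dupNamespace false

open AlgebraicGeometry CategoryTheory Literature.AlgebraicGeometry.Resolution

namespace Summit.ResolutionOfSingularities.ResolutionOfSingularities.Cruxes.DescentPerfectToAll.ValuativeConstantStep

/-! ## Vocabulary of the line (local abbreviations; every constant is an existing tree / Mathlib declaration) -/

/-- The crux's ANTECEDENT at `p`, verbatim shape: resolution of reduced separated schemes of finite type over every
PERFECT field of characteristic `p`. -/
def AntecedentAt (p : ℕ) : Prop :=
  ∀ (k : Type) [Field k] [CharP k p] [PerfectField k] (X : Scheme.{0}) (f : X ⟶ Spec (.of k)),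
    IsSeparated f → LocallyOfFiniteType f → QuasiCompact f → IsReduced X → Scheme.HasResolution X

/-- The OPEN CORE of valuation rings `O ∋ k` of `K/k` for rung B's local door: rank one (Novacoski–Spivakovsky 2014 removes
the rest), residually algebraic over `k` (ground-field enlargement removes the rest), NOT discrete with finite separable
residue extension (Knaf–Kuhlmann 2009 Thm 1.5 covers those), NOT an Abhyankar place (Cutkosky 2022 Thm 1.3, PROVED in the
tree over any field), and `trdeg_k K ≥ 4` (Cossart–Piltant 2019 covers `≤ 3`). [folklore bookkeeping of cited reductions] -/
def IsCoreValuationRing (k : Type) {K : Type} [Field k] [Field K] [Algebra k K] (O : ValuationSubring K) : Prop :=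
  Nonempty O.valuation.RankOne ∧ IsResiduallyAlgebraic k O ∧ ¬ IsDiscreteWithSeparableResidue k O ∧
    ¬ IsAbhyankarPlace O (algebraMap k K).fieldRange ⊤ ∧ ¬ Algebra.trdeg k K ≤ 3

/-- `ConstStepDescent_p` — ONE-CONSTANT-STEP DESCENT OF A RELATIVE LOCAL-UNIFORMIZATION CERTIFICATE (the line's lever,
OPEN).  Fields `k ⊆ K ⊆ L` of characteristic `p`, `L/K` purely inseparable generated by one `y` with `y ^ p ∈ k`
(a `p`-th root of a CONSTANT); `O` a valuation ring of `L` whose trace `O_K` on `K` lies in the open core; `R ⊆ K` an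
affine model (`R` f.g., `Frac R = K`); `B ⊆ O` a finitely generated `k`-subalgebra of `L` containing `R` and REGULAR AT
THE CENTRE of `O`.  Conclusion: an `A ⊇ R`, finitely generated, inside `O_K`, regular at the centre of `O_K` — i.e. the
`RelLocalUniformization` certificate of `R` descends the constant step.  Over perfect `k` it is trivial (`y ∈ k`, `L = K`). -/
def ConstStepDescent (p : ℕ) : Prop :=
  ∀ (k K L : Type) [Field k] [CharP k p] [Field K] [Field L] [Algebra k K] [Algebra K L]
    [Algebra k L] [IsScalarTower k K L],
    IsPurelyInseparable K L →
    (∃ y : L, y ^ p ∈ (algebraMap k L).range ∧ IntermediateField.adjoin K {y} = ⊤) →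
    ∀ O : ValuationSubring L, IsCoreValuationRing k (O.comap (algebraMap K L)) →
    ∀ R : Subalgebra k K, R.FG → IsFractionRing R K →
    ∀ (B : Subalgebra k L) (hB : B.toSubring ≤ O.toSubring), B.FG →
      R.map (IsScalarTower.toAlgHom k K L) ≤ B →
      IsRegularLocalRing
        (Localization.AtPrime (Ideal.comap (Subring.inclusion hB) (IsLocalRing.maximalIdeal O))) →
      ∃ (A : Subalgebra k K) (hA : A.toSubring ≤ (O.comap (algebraMap K L)).toSubring),
        R ≤ A ∧ A.FG ∧ IsRegularLocalRing (Localization.AtPrime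
          (Ideal.comap (Subring.inclusion hA) (IsLocalRing.maximalIdeal (O.comap (algebraMap K L)))))

/-! ### v2: the valuation type of the generator (E / F / D) and the case-restricted step -/

/-- Type E (RAMIFIED, `e = p`): some translate `y - a`, `a ∈ K`, has a value not attained on `K` (for `[L : K] = p` prime
this is equivalent to `(v(Lˣ) : v(Kˣ)) = p` — linear-witness lemma, stub-plan §1.1). -/
def RamifiedGen (K : Type) {L : Type} [Field K] [Field L] [Algebra K L] (O : ValuationSubring L) (y : L) : Prop :=
  ∃ a : K, ∀ b : K, O.valuation (y - algebraMap K L a) ≠ O.valuation (algebraMap K L b)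

/-- Type F (INERT, `f = p`): some `w = (y - a) / b`, `a b ∈ K`, is a UNIT of `O` whose residue class is not the class of
any element of `K` (then `1, w, …, w^{p-1}` is a valuation basis and `O = (O ∩ K)[w]`). -/
def InertGen (K : Type) {L : Type} [Field K] [Field L] [Algebra K L] (O : ValuationSubring L) (y : L) : Prop :=
  ∃ a b : K, O.valuation ((y - algebraMap K L a) / algebraMap K L b) = 1 ∧
    ∀ e : K, 1 ≤ O.valuation ((y - algebraMap K L a) / algebraMap K L b - algebraMap K L e)

/-- Type D (IMMEDIATE = DEFECT, `e = f = 1`, `d = p`): neither ramified nor inert (no best approximation of `y` from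
`K`; requires the residue field to contain a `p`-th root of the residue of `y ^ p`). -/
def ImmediateGen (K : Type) {L : Type} [Field K] [Field L] [Algebra K L] (O : ValuationSubring L) (y : L) : Prop :=
  ¬ RamifiedGen K O y ∧ ¬ InertGen K O y

/-- `ConstStepDescent p` RESTRICTED to purely inseparable generators `y` of valuation type `Φ` at `O` (same binders as
`ConstStepDescent`, generator exposed, case hypothesis inserted after `O`). -/
def ConstStepDescentIf (p : ℕ)
    (Φ : ∀ (K L : Type) [Field K] [Field L] [Algebra K L], ValuationSubring L → L → Prop) : Prop :=
  ∀ (k K L : Type) [Field k] [CharP k p] [Field K] [Field L] [Algebra k K] [Algebra K L]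
    [Algebra k L] [IsScalarTower k K L],
    IsPurelyInseparable K L →
    ∀ y : L, y ^ p ∈ (algebraMap k L).range → IntermediateField.adjoin K {y} = ⊤ →
    ∀ O : ValuationSubring L, Φ K L O y → IsCoreValuationRing k (O.comap (algebraMap K L)) →
    ∀ R : Subalgebra k K, R.FG → IsFractionRing R K →
    ∀ (B : Subalgebra k L) (hB : B.toSubring ≤ O.toSubring), B.FG →
      R.map (IsScalarTower.toAlgHom k K L) ≤ B →
      IsRegularLocalRing
        (Localization.AtPrime (Ideal.comap (Subring.inclusion hB) (IsLocalRing.maximalIdeal O))) →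
      ∃ (A : Subalgebra k K) (hA : A.toSubring ≤ (O.comap (algebraMap K L)).toSubring),
        R ≤ A ∧ A.FG ∧ IsRegularLocalRing (Localization.AtPrime
          (Ideal.comap (Subring.inclusion hA) (IsLocalRing.maximalIdeal (O.comap (algebraMap K L)))))

/-- Case E of the constant step. -/
def ConstStepDescentRamified (p : ℕ) : Prop :=
  ConstStepDescentIf p (fun K _ _ _ _ O y => RamifiedGen K O y)

/-- Case F of the constant step. -/
def ConstStepDescentInert (p : ℕ) : Prop :=
  ConstStepDescentIf p (fun K _ _ _ _ O y => InertGen K O y)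

/-- Case D of the constant step (HARDEST: defect / inseparable-residue valuations, outside every Knaf–Kuhlmann mechanism). -/
def ConstStepDescentImmediate (p : ℕ) : Prop :=
  ConstStepDescentIf p (fun K _ _ _ _ O y => ImmediateGen K O y)

/-- `DiscreteInseparableResidueLU_p` — the MINIMAL HARD FAMILY (stub-plan §1.3; typed target, first rung of the line):
relative LU of `K/k` at DISCRETE rank-one valuation rings `O ∋ k` whose residue field is purely inseparable algebraic over
the image of `k` (`∀ t ∈ O, ∃ c n, v(t^{p^n} - c) < 1`) and different from it (`∃ t ∈ O, ∀ c, 1 ≤ v(t - c)`).  Exactly the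
discrete rank-one valuation rings outside Knaf–Kuhlmann 2009 Thm 1.5; empty over perfect `k`; upstairs (residues' roots
adjoined) KK's rational-discrete case gives the certificate for free, so here the constant steps ARE the whole problem.
OPEN (believed; `trdeg ≤ 3` is Cossart–Piltant 2019). [folklore statement; open] -/
def DiscreteInseparableResidueLU (p : ℕ) : Prop :=
  ∀ (k K : Type) [Field k] [CharP k p] [Field K] [Algebra k K], (⊤ : IntermediateField k K).FG →
    ∀ O : ValuationSubring K, (∀ c : k, algebraMap k K c ∈ O) → IsDiscreteValuationRing O →
      (∀ t : K, t ∈ O → ∃ (c : k) (n : ℕ), O.valuation (t ^ p ^ n - algebraMap k K c) < 1) →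
      (∃ t : K, t ∈ O ∧ ∀ c : k, 1 ≤ O.valuation (t - algebraMap k K c)) →
        RelLocalUniformization k K O

/-- `CoreDescent_p` — the BOOKKEEPING stub's statement: Knaf–Kuhlmann 2009 Thm 1.5 + the antecedent + the constant step
give relative local uniformization on the open core (perfect-closure ascent, finitely generated descent to a finite constant
level, flat descent of regularity, top-down peel of the height-one constant tower). -/
def CoreDescent (p : ℕ) : Prop :=
  KnafKuhlmann2009MonogenicCompletion → AntecedentAt p → ConstStepDescent p →
    ∀ (k K : Type) [Field k] [CharP k p] [Field K] [Algebra k K], (⊤ : IntermediateField k K).FG →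
      ∀ O : ValuationSubring K, (∀ c : k, algebraMap k K c ∈ O) → IsCoreValuationRing k O →
        RelLocalUniformization k K O

/-- `TwoModelPatchingImperfectGeFour_p` — two-model patching of proper models (`ProperModel.TwoModelPatching` restricted)
over IMPERFECT ground fields of characteristic `p` in transcendence degree `≥ 4` (OPEN; Piltant 2013 p. 2: open in `≥ 4`
over every field; shared with route Valuative's `PatchingRel`). -/
def TwoModelPatchingImperfectGeFour (p : ℕ) : Prop :=
  ∀ (k : Type) [Field k] [CharP k p], ¬ PerfectField k →
    ∀ (K : Type) [Field K] [Algebra k K] [Algebra.EssFiniteType k K], ¬ Algebra.trdeg k K ≤ 3 →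
      ∀ M₁ M₂ : ProperModel k K,
        ∃ (N : ProperModel k K) (φ₁ : N.Hom M₁) (φ₂ : N.Hom M₂), φ₁.RegLe ∧ φ₂.RegLe

/-! ## Registered stubs (the ONLY sorries of this file) -/

/-- STUB 1 (named printed fact, typed & undischarged in the tree): Cossart–Piltant 2019 Thm 1.1 — resolution of reduced
separated schemes of finite type of dimension `≤ 3` over any field. [cite: CossartPiltant2019, Thm. 1.1] -/
theorem stub_cossartPiltant2019 : CossartPiltant2019.{0} := by
  sorry

/-- STUB 2 (named printed fact, typed & undischarged in the tree): Knaf–Kuhlmann 2009 Thm 1.5 for monogenic Abhyankar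
subfields — relative LU at valuation rings containing a `y` with separable residue and `k(y)` dense.
[cite: KnafKuhlmann2009, Thm. 1.5] -/
theorem stub_knafKuhlmann2009 : KnafKuhlmann2009MonogenicCompletion := by
  sorry

/-- STUB 3 (bookkeeping, M/L; believed provable with tree tools — `exists_affineModel_regular_of_hasResolution`,
`IsRegularLocalRing.of_flat_of_isLocalHom`, `relLocalUniformization_of_isDiscreteWithSeparableResidue`, the peel template
`isLocallyUniformizable_comap_of_rrLU1`): antecedent + Knaf–Kuhlmann + constant step ⇒ relative LU on the open core.
[folklore assembly of cited results] -/
theorem stub_coreDescent : ∀ p : ℕ, p.Prime → CoreDescent p := by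
  sorry

/-- STUB 4E (OPEN; v2): the constant step for generators of RAMIFIED type — a Kummer FUNCTION step in disguise
(`w = (y-a)/b`, `w^p = u ∈ K`, `v(u) ∉ p·v(Kˣ)`). [folklore statement; open] -/
theorem stub_constStepDescent_ramified : ∀ p : ℕ, p.Prime → ConstStepDescentRamified p := by
  sorry

/-- STUB 4F (OPEN; v2): the constant step for generators of INERT type (`O_L = O_K[w]` free on a valuation basis; contains
the residually-rational non-discrete core). [folklore statement; open] -/
theorem stub_constStepDescent_inert : ∀ p : ℕ, p.Prime → ConstStepDescentInert p := by
  sorry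

/-- STUB 4D (OPEN — THE HARDEST; v2): the constant step for generators of IMMEDIATE type (defect `d = p`; residue field
inseparable over `k`; no completion-density mechanism reaches it — KK 2009 Lemma 3.12). First rung:
`DiscreteInseparableResidueLU`. [folklore statement; open] -/
theorem stub_constStepDescent_immediate : ∀ p : ℕ, p.Prime → ConstStepDescentImmediate p := by
  sorry

/-- STUB 5 (OPEN, shared debt): two-model patching of proper models over imperfect fields in `trdeg ≥ 4`, granted the
antecedent. [cite: Piltant2013, Prop. 5.1 (P = P_reg); open in trdeg ≥ 4, p. 2] -/
theorem stub_twoModelPatchingImperfectGeFour :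
    ∀ p : ℕ, p.Prime → AntecedentAt p → TwoModelPatchingImperfectGeFour p := by
  sorry

/-! ## Sorry-free glue -/

section Glue

variable {p : ℕ}

/-- **Relative LU in characteristic `p` from relative LU on the open core** — the tree's sorry-free reductions chained:
Novacoski–Spivakovsky (rank one), residually-algebraic ground-field enlargement, Knaf–Kuhlmann (discrete separable residue,
hypothesis), Cossart–Piltant (trdeg `≤ 3`, hypothesis), Cutkosky (Abhyankar places, PROVED).
[cite: NovacoskiSpivakovsky2014, Thm. 1.1; KnafKuhlmann2009, Thm. 1.5; CossartPiltant2019, Thm. 1.1; Cutkosky2022, Thm. 1.3] -/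
theorem relLocalUniformization_of_core [Fact p.Prime] (hCP : CossartPiltant2019LU3.{0})
    (hKK : KnafKuhlmann2009MonogenicCompletion)
    (H : ∀ (k K : Type) [Field k] [CharP k p] [Field K] [Algebra k K], (⊤ : IntermediateField k K).FG →
      ∀ O : ValuationSubring K, (∀ c : k, algebraMap k K c ∈ O) → IsCoreValuationRing k O →
        RelLocalUniformization k K O)
    (k K : Type) [Field k] [CharP k p] [Field K] [Algebra k K] (O : ValuationSubring K) :
    RelLocalUniformization k K O := by
  classical
  refine NovacoskiSpivakovsky2014_holds k (fun K _ _ O hr => ?_) K O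
  intro R hRfg hRfr hRO
  have hk : ∀ c : k, algebraMap k K c ∈ O := algebraMap_mem_of_le O R hRO
  have hfg : (⊤ : IntermediateField k K).FG := fg_top_of_model R hRfg hRfr
  refine relLocalUniformization_of_forall_isResiduallyAlgebraic hfg O hk (fun k₁ hk₁O hra => ?_)
    R hRfg hRfr hRO
  haveI : CharP k₁ p := charP_of_injective_algebraMap (algebraMap k k₁).injective p
  have hfg₁ : (⊤ : IntermediateField k₁ K).FG := intermediateField_fg_top_of_fg_top k₁ hfg
  have hk₁ : ∀ c : k₁, algebraMap k₁ K c ∈ O := hk₁O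
  by_cases hrd : IsDiscreteWithSeparableResidue k₁ O
  · exact relLocalUniformization_of_isDiscreteWithSeparableResidue hKK hfg₁ O hk₁ hrd
  by_cases h3 : Algebra.trdeg k₁ K ≤ 3
  · exact CossartPiltant2019LU3.relLocalUniformization hCP k₁ K h3 O
  by_cases hA : IsAbhyankarPlace O (algebraMap k₁ K).fieldRange ⊤
  · exact relLocalUniformization_of_isAbhyankarPlace hfg₁ O hk₁ hA
  exact H k₁ K hfg₁ O hk₁ ⟨hr, hra, hrd, hA, h3⟩

/-- Weak LU in characteristic `p` (`LocalUniformizationInChar p`, the LU conjunct of Zariski's reduction) from relative LU on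
the open core. [cite: NovacoskiSpivakovsky2014, Thm. 1.1; KnafKuhlmann2009, Thm. 1.5; CossartPiltant2019, Thm. 1.1; Cutkosky2022, Thm. 1.3] -/
theorem localUniformizationInChar_of_core [Fact p.Prime] (hCP : CossartPiltant2019LU3.{0})
    (hKK : KnafKuhlmann2009MonogenicCompletion)
    (H : ∀ (k K : Type) [Field k] [CharP k p] [Field K] [Algebra k K], (⊤ : IntermediateField k K).FG →
      ∀ O : ValuationSubring K, (∀ c : k, algebraMap k K c ∈ O) → IsCoreValuationRing k O →
        RelLocalUniformization k K O) :
    LocalUniformizationInChar.{0} p := fun k K _ _ _ _ hfg O hk =>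
  isLocallyUniformizable_of_relLocalUniformization hfg O hk (relLocalUniformization_of_core hCP hKK H k K O)

/-- Two-model patching in characteristic `p` from: the antecedent (perfect `k`, through `resOver_iff_luAt_and_tmpAt`),
Cossart–Piltant (`trdeg ≤ 3`, through `twoModelPatching_of_trdeg_le_three`) and the imperfect `trdeg ≥ 4` residue.
[cite: CossartPiltant2019, Thm. 1.1; Piltant2013, Prop. 5.1] -/
theorem twoModelPatching_of_antecedent (hCP : CossartPiltant2019.{0}) (hP : AntecedentAt p)
    (h4 : TwoModelPatchingImperfectGeFour p) : ProperModel.TwoModelPatching.{0} p := by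
  intro k _ _ K _ _ _ M₁ M₂
  by_cases hk : PerfectField k
  · exact ((Theorems.PalterationThesis.ZariskiPerfect.resOver_iff_luAt_and_tmpAt k).mp
      (fun X f hs hl hq hr => hP k X f hs hl hq hr)).2 K M₁ M₂
  · by_cases h3 : Algebra.trdeg k K ≤ 3
    · exact Theorems.Pialt.OpenRange.twoModelPatching_of_trdeg_le_three hCP h3 M₁ M₂
    · exact h4 k hk K h3 M₁ M₂

/-- CONSISTENCY: the open step is a consequence of the crux's consequent at `p` (resolution in characteristic `p` gives
relative LU outright, `ResolutionInChar.relLocalUniformization`) — `ConstStepDescent` is implied by, not stronger than,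
the target. [folklore] -/
theorem constStepDescent_of_resolutionInChar (h : ResolutionInChar.{0} p) : ConstStepDescent p := by
  intro k K L _ _ _ _ _ _ _ _ _ _ O _ R hRfg hRfr B hB _ hRB _
  have hRO : R.toSubring ≤ (O.comap (algebraMap K L)).toSubring := by
    intro x hx
    rw [Subalgebra.mem_toSubring] at hx
    show algebraMap K L x ∈ O
    exact hB (hRB ⟨x, hx, rfl⟩)
  exact h.relLocalUniformization k K (O.comap (algebraMap K L)) R hRfg hRfr hRO

/-- CONSISTENCY: the bookkeeping stub's conclusion is likewise a consequence of `ResolutionInChar p`. [folklore] -/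
theorem coreDescent_of_resolutionInChar (h : ResolutionInChar.{0} p) : CoreDescent p :=
  fun _ _ _ k K _ _ _ _ _ O _ _ => h.relLocalUniformization k K O

/-- v2 CASE ASSEMBLY (pure logic): the three case-restricted statements give `ConstStepDescent p`; exhaustiveness of
E / F / D is definitional (`ImmediateGen = ¬E ∧ ¬F`). [folklore] -/
theorem constStepDescent_of_cases (hE : ConstStepDescentRamified p) (hF : ConstStepDescentInert p)
    (hD : ConstStepDescentImmediate p) : ConstStepDescent p := by
  intro k K L _ _ _ _ _ _ _ _ hPI hy O hcore R hRfg hRfr B hB hBfg hRB hreg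
  obtain ⟨y, hyp, hadj⟩ := hy
  by_cases h1 : RamifiedGen K O y
  · exact hE k K L hPI y hyp hadj O h1 hcore R hRfg hRfr B hB hBfg hRB hreg
  · by_cases h2 : InertGen K O y
    · exact hF k K L hPI y hyp hadj O h2 hcore R hRfg hRfr B hB hBfg hRB hreg
    · exact hD k K L hPI y hyp hadj O ⟨h1, h2⟩ hcore R hRfg hRfr B hB hBfg hRB hreg

/-- v2 ANTI-COSTUME DIRECTION: every case-restricted statement is implied by the unrestricted step (drop the case
hypothesis) — each sub-stub is at most as strong as `ConstStepDescent p`. [folklore] -/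
theorem constStepDescentIf_of_constStepDescent
    (Φ : ∀ (K L : Type) [Field K] [Field L] [Algebra K L], ValuationSubring L → L → Prop)
    (h : ConstStepDescent p) : ConstStepDescentIf p Φ := by
  intro k K L _ _ _ _ _ _ _ _ hPI y hyp hadj O _ hcore R hRfg hRfr B hB hBfg hRB hreg
  exact h k K L hPI ⟨y, hyp, hadj⟩ O hcore R hRfg hRfr B hB hBfg hRB hreg

/-- v2: the old stub 4 STATEMENT `∀ p, p.Prime → ConstStepDescent p`, now DERIVED from the three sub-stubs (sorried only
through them). -/
theorem constStepDescent_of_substubs : ∀ p : ℕ, p.Prime → ConstStepDescent p := fun p hp =>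
  constStepDescent_of_cases (stub_constStepDescent_ramified p hp) (stub_constStepDescent_inert p hp)
    (stub_constStepDescent_immediate p hp)

/-- v2 CONSISTENCY: the minimal hard family is a consequence of the crux's consequent `ResolutionInChar p`. [folklore] -/
theorem discreteInseparableResidueLU_of_resolutionInChar (h : ResolutionInChar.{0} p) :
    DiscreteInseparableResidueLU p :=
  fun k K _ _ _ _ _ O _ _ _ _ => h.relLocalUniformization k K O

end Glue

/-! ## The composition concluding the crux BY NAME -/

/-- COMPOSITION (kernel-checked, no sorry): the five stub STATEMENTS imply the crux `Theses.Descent.DescentPerfectToAll`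
through Zariski's reduction `resolutionInChar_iff_twoModelPatching_and_lu`.
[cite: Zariski1944, pp. 490–491, 537–538; NovacoskiSpivakovsky2014, Thm. 1.1; CossartPiltant2019, Thm. 1.1; KnafKuhlmann2009, Thm. 1.5; Cutkosky2022, Thm. 1.3] -/
theorem DescentPerfectToAll_of
    (h₁ : CossartPiltant2019.{0})
    (h₂ : KnafKuhlmann2009MonogenicCompletion)
    (h₃ : ∀ p : ℕ, p.Prime → CoreDescent p)
    (h₄ : ∀ p : ℕ, p.Prime → ConstStepDescent p)
    (h₅ : ∀ p : ℕ, p.Prime → AntecedentAt p → TwoModelPatchingImperfectGeFour p) :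
    Summit.ResolutionOfSingularities.ResolutionOfSingularities.Theses.Descent.DescentPerfectToAll := by
  intro p hp hP
  haveI : Fact p.Prime := ⟨hp⟩
  refine resolutionInChar_iff_twoModelPatching_and_lu.mpr
    ⟨twoModelPatching_of_antecedent h₁ hP (h₅ p hp hP), ?_⟩
  exact localUniformizationInChar_of_core h₁.lu3 h₂ (h₃ p hp h₂ hP (h₄ p hp))

/-- v2 COMPOSITION from the SEVEN registered stub statements (kernel-checked, no sorry): the crux BY NAME.
[cite: Zariski1944, pp. 490–491, 537–538; NovacoskiSpivakovsky2014, Thm. 1.1; CossartPiltant2019, Thm. 1.1; KnafKuhlmann2009, Thm. 1.5; Cutkosky2022, Thm. 1.3] -/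
theorem DescentPerfectToAll_of7
    (h₁ : CossartPiltant2019.{0})
    (h₂ : KnafKuhlmann2009MonogenicCompletion)
    (h₃ : ∀ p : ℕ, p.Prime → CoreDescent p)
    (h₄E : ∀ p : ℕ, p.Prime → ConstStepDescentRamified p)
    (h₄F : ∀ p : ℕ, p.Prime → ConstStepDescentInert p)
    (h₄D : ∀ p : ℕ, p.Prime → ConstStepDescentImmediate p)
    (h₅ : ∀ p : ℕ, p.Prime → AntecedentAt p → TwoModelPatchingImperfectGeFour p) :
    Summit.ResolutionOfSingularities.ResolutionOfSingularities.Theses.Descent.DescentPerfectToAll :=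
  DescentPerfectToAll_of h₁ h₂ h₃ (fun p hp => constStepDescent_of_cases (h₄E p hp) (h₄F p hp) (h₄D p hp)) h₅

/-- THE SKELETON THEOREM for the register (v2): the item's own decl from the SEVEN DECLARED STUBS by name (sorried stubs;
no other hypothesis). [cite: Zariski1944, pp. 490–491, 537–538] -/
theorem DescentPerfectToAll_proof :
    Summit.ResolutionOfSingularities.ResolutionOfSingularities.Theses.Descent.DescentPerfectToAll :=
  DescentPerfectToAll_of7 stub_cossartPiltant2019 stub_knafKuhlmann2009 stub_coreDescent stub_constStepDescent_ramified
    stub_constStepDescent_inert stub_constStepDescent_immediate stub_twoModelPatchingImperfectGeFour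

end Summit.ResolutionOfSingularities.ResolutionOfSingularities.Cruxes.DescentPerfectToAll.ValuativeConstantStep

end
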